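import Literature.Probability.Percolation.QuadCrossingCrossedEventInterior
import Literature.Probability.Percolation.QuadCrossingRotationInvarianceOfSS
import Literature.Probability.Percolation.QuadCrossingSubseqLimits
import Mathlib.MeasureTheory.Measure.Prokhorov
import Mathlib.MeasureTheory.Measure.LevyProkhorovMetric
import HarnessLib

/-!
# Schramm–Smirnov's discrete continuity (5.1) from their Lemma 5.1; DKKMO Cor. 1.3 modulo
# Theorem 1.2 (`d_SS`) and Lemma 5.1

Topic `Probability/Percolation`; companion of `QuadCrossingContinuityEventsProofs.lean`
(`SchrammSmirnov2011_lemma_5_1_of_continuity`: the named fact `SchrammSmirnov2011_lemma_5_1` —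
every subsequential scaling limit `μ` of critical bond percolation on `δℤ²` in `ℋ_D` has
`μ(∂⊞_{Q₀}) = 0` — follows from the discrete estimate (5.1): for every quad `Q₀` and `ε > 0`
there are `Q' < Q₀ < Q''` and `δ₀ > 0` with `P_{1/2}[Q' crossed inside the open edges ∧ Q'' not] ≤ ε`
for `0 < δ < δ₀`) and of `QuadCrossingRotationInvarianceOfSS.lean` (DKKMO's Cor. 1.3 at `q = 1`
from the `d_SS` half of their Theorem 1.2 and exactly this estimate at `D = univ`).

* `Quad.continuity_of_lemma_5_1` — **the converse at `D = univ`: Lemma 5.1 implies (5.1)** for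
  every quad of the plane. So (5.1) on `ℋ_ℂ` and Lemma 5.1 are two forms of one statement, and
  any proof of the named fact discharges the continuity input of DKKMO's corollary:
* `dkkmo_crossing_rotation_invariance_of_schrammSmirnov_of_lemma_5_1` — **DKKMO Cor. 1.3
  (`q = 1`) from the Schramm–Smirnov half of DKKMO Thm. 1.2 (hypothesis `hSS`, as in
  `QuadCrossingRotationInvarianceOfSS`) and the named fact `SchrammSmirnov2011_lemma_5_1`.**

Proof of the converse (not in the source, which goes the other way; standard weak-convergence
argument). Fix a perturbation family of `Q₀` (`Quad.PerturbFamily`, from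
`Quad.exists_perturbations`: `Q₋(t) < Q₀ < Q₊(t)`, `Q∓(t) → Q₀` uniformly) and nested parameters
`t_n ↓ 0` with `Q₋(t_n) ↑`, `Q₊(t_n) ↓` strictly in Schramm–Smirnov's order (`PerturbFamily.seq`;
the witnessing neighbourhoods of `<` are open). If (5.1) failed at `Q₀`, there would be meshes
`δ_n → 0` with `P[E_{n+1}(δ_n)] > ε`, `E_k(δ) = {Q₋(t_k) crossed ∧ Q₊(t_k) not}`; these events
decrease in `k`, and `E_{m+1}(δ) ⊆ {S_ω ∈ F_m}` with `F_m = ⊞_{Q₋(t_{m+1})} ∩ closure V^{Q₊(t_m)}`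
closed and decreasing. The laws `μ_{δ_n}` are probability measures on the compact metrizable
`ℋ_ℂ` (Schramm–Smirnov Thm. 1.4, proved in the tree; measurability of `ω ↦ S_ω`), so a
subsequence converges weakly (Mathlib: the probability measures on a compact space form a
compact space, metrizable by Lévy–Prokhorov) to a subsequential scaling limit `μ`; portmanteau
gives `μ(F_m) ≥ ε`, hence `μ(⋂ F_m) ≥ ε`. But `⋂ F_m ⊆ ∂⊞_{Q₀}`: a configuration in all `F_m`
contains `Q₀` (limit of `Q₋(t_m)`, closedness) and no `Q > Q₀` (such a `Q` would be above
`Q₊(t_n)` for large `n`, while `closure V^{Q₊(t_{m+1})} ⊆ V^{Q₊(t_m)}`), and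
`∂⊞_{Q₀} = {Q₀ crossed, no Q > Q₀ crossed}` (`QuadConfig.frontier_crossedEvent_eq`). This
contradicts `μ(∂⊞_{Q₀}) = 0`.

Everything is proved; no named fact is introduced (the two facts enter as hypotheses).

## References

* O. Schramm, S. Smirnov, Ann. Probab. 39 (2011) 1768–1814, arXiv:1101.5820, §1.3, Thm. 1.4,
  Cor. 1.6, §5 (Lemma 5.1, eq. (5.1)). [SchrammSmirnov2011]
* H. Duminil-Copin, K. K. Kozlowski, D. Krachun, I. Manolescu, M. Oulamara, arXiv:2012.11672v1,
  Thm. 1.2 and Cor. 1.3. [DKKMO2020Rotational]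
-/

noncomputable section

open Set Filter Metric
open _root_.Topology _root_.MeasureTheory
open scoped unitInterval ENNReal
open Literature.Probability.LatticeModels

namespace Literature.Probability.Percolation

namespace QuadCrossing

namespace Quad

/-! ### Perturbation families of a quad of the plane -/

/-- The chart point `(2x - 1) + (2y - 1)i ∈ [-1, 1]²` of `p = (x, y) ∈ [0, 1]²`. [folklore] -/
def chartPt (p : I × I) : ℂ := ((2 * (p.1 : ℝ) - 1 : ℝ) : ℂ) + ((2 * (p.2 : ℝ) - 1 : ℝ) : ℂ) * Complex.I

/-- The shrunk chart point `(1-t)(2x-1) + i(1+t)(2y-1)` (image of the taller, narrower rectangle).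
[folklore] -/
def shrinkPt (t : ℝ) (p : I × I) : ℂ :=
  ((((1 - t) * (2 * (p.1 : ℝ) - 1)) : ℝ) : ℂ) + ((((1 + t) * (2 * (p.2 : ℝ) - 1)) : ℝ) : ℂ) * Complex.I

/-- The stretched chart point `(2x-1)/(1-t) + i(2y-1)/(1+t)` (image of the wider, shorter
rectangle). [folklore] -/
def stretchPt (t : ℝ) (p : I × I) : ℂ :=
  ((((2 * (p.1 : ℝ) - 1) / (1 - t)) : ℝ) : ℂ) + ((((2 * (p.2 : ℝ) - 1) / (1 + t)) : ℝ) : ℂ) * Complex.I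

/-- The shrunk and stretched chart points are within `4t` of the chart point (`0 ≤ t ≤ 1/2`).
[folklore] -/
theorem dist_shrinkPt_le {t : ℝ} (ht : 0 ≤ t) (p : I × I) :
    dist (shrinkPt t p) (chartPt p) ≤ 2 * t := by
  have h1 := p.1.2; have h2 := p.2.2
  simp only [mem_Icc] at h1 h2
  rw [dist_eq_norm]
  have e : shrinkPt t p - chartPt p =
      ((-(t * (2 * (p.1 : ℝ) - 1)) : ℝ) : ℂ) + (((t * (2 * (p.2 : ℝ) - 1)) : ℝ) : ℂ) * Complex.I := by
    simp only [shrinkPt, chartPt]; push_cast; ring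
  rw [e]
  refine (Complex.norm_le_abs_re_add_abs_im _).trans ?_
  rw [(re_im_ofReal_add_ofReal_mul_I _ _).1, (re_im_ofReal_add_ofReal_mul_I _ _).2, abs_neg, abs_mul,
    abs_mul, abs_of_nonneg ht]
  have ha : |2 * (p.1 : ℝ) - 1| ≤ 1 := abs_le.2 ⟨by linarith [h1.1], by linarith [h1.2]⟩
  have hb : |2 * (p.2 : ℝ) - 1| ≤ 1 := abs_le.2 ⟨by linarith [h2.1], by linarith [h2.2]⟩
  nlinarith [abs_nonneg (2 * (p.1 : ℝ) - 1), abs_nonneg (2 * (p.2 : ℝ) - 1)]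

/-- See `dist_shrinkPt_le`. [folklore] -/
theorem dist_stretchPt_le {t : ℝ} (ht : 0 ≤ t) (ht' : t ≤ 1 / 2) (p : I × I) :
    dist (stretchPt t p) (chartPt p) ≤ 4 * t := by
  have h1 := p.1.2; have h2 := p.2.2
  simp only [mem_Icc] at h1 h2
  have ha1 : (0 : ℝ) < 1 - t := by linarith
  have hb1 : (0 : ℝ) < 1 + t := by linarith
  rw [dist_eq_norm]
  have e : stretchPt t p - chartPt p =
      (((t / (1 - t) * (2 * (p.1 : ℝ) - 1)) : ℝ) : ℂ) +
        (((-(t / (1 + t)) * (2 * (p.2 : ℝ) - 1)) : ℝ) : ℂ) * Complex.I := by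
    simp only [stretchPt, chartPt]
    have e1 : (2 * (p.1 : ℝ) - 1) / (1 - t) - (2 * (p.1 : ℝ) - 1) = t / (1 - t) * (2 * (p.1 : ℝ) - 1) := by
      field_simp; ring
    have e2 : (2 * (p.2 : ℝ) - 1) / (1 + t) - (2 * (p.2 : ℝ) - 1) = -(t / (1 + t)) * (2 * (p.2 : ℝ) - 1) := by
      field_simp; ring
    rw [← e1, ← e2]; push_cast; ring
  rw [e]
  refine (Complex.norm_le_abs_re_add_abs_im _).trans ?_
  rw [(re_im_ofReal_add_ofReal_mul_I _ _).1, (re_im_ofReal_add_ofReal_mul_I _ _).2, abs_mul, abs_mul,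
    abs_neg, abs_of_nonneg (div_nonneg ht ha1.le), abs_of_nonneg (div_nonneg ht hb1.le)]
  have ha : |2 * (p.1 : ℝ) - 1| ≤ 1 := abs_le.2 ⟨by linarith [h1.1], by linarith [h1.2]⟩
  have hb : |2 * (p.2 : ℝ) - 1| ≤ 1 := abs_le.2 ⟨by linarith [h2.1], by linarith [h2.2]⟩
  have hd1 : t / (1 - t) ≤ 2 * t := by rw [div_le_iff₀ ha1]; nlinarith
  have hd2 : t / (1 + t) ≤ t := by rw [div_le_iff₀ hb1]; nlinarith
  nlinarith [abs_nonneg (2 * (p.1 : ℝ) - 1), abs_nonneg (2 * (p.2 : ℝ) - 1),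
    div_nonneg ht ha1.le, div_nonneg ht hb1.le]

/-- **A perturbation family of the quad `Q₀ ∈ 𝒬_ℂ`** (Schramm–Smirnov's `Q^{q_{∓s}}`, packaged
from `Quad.exists_perturbations`): a plane homeomorphism `H` through which `Q₀` is the chart of
the square, `t₀ ∈ (0, 1/2]`, and for `0 < t ≤ t₀` quads `Q₋(t) = H ∘ A_t ∘ chart < Q₀ < Q₊(t) =
H ∘ A_t⁻¹ ∘ chart`. [cite: SchrammSmirnov2011, proof of Lemma 5.1] -/
structure PerturbFamily (Q₀ : Quad (univ : Set ℂ)) where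
  /-- the plane homeomorphism extending `Q₀` -/
  H : ℂ ≃ₜ ℂ
  /-- the admissible range of the perturbation parameter -/
  t₀ : ℝ
  /-- the inner perturbations `Q₋(t)` -/
  Qm : ℝ → Quad (univ : Set ℂ)
  /-- the outer perturbations `Q₊(t)` -/
  Qp : ℝ → Quad (univ : Set ℂ)
  /-- `t₀ > 0` -/
  t₀_pos : 0 < t₀
  /-- `t₀ ≤ 1/2` -/
  t₀_le : t₀ ≤ 1 / 2
  /-- `Q₀` is the chart of the square through `H` -/
  apply_chartPt : ∀ p : I × I, H (chartPt p) = Q₀ p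
  /-- formula for the inner perturbations -/
  Qm_apply : ∀ {t : ℝ}, 0 < t → t ≤ t₀ → ∀ p : I × I, Qm t p = H (shrinkPt t p)
  /-- formula for the outer perturbations -/
  Qp_apply : ∀ {t : ℝ}, 0 < t → t ≤ t₀ → ∀ p : I × I, Qp t p = H (stretchPt t p)
  /-- `Q₋(t) < Q₀` -/
  Qm_lt : ∀ {t : ℝ}, 0 < t → t ≤ t₀ → StrictlyDominated (Qm t) Q₀
  /-- `Q₀ < Q₊(t)` -/
  lt_Qp : ∀ {t : ℝ}, 0 < t → t ≤ t₀ → StrictlyDominated Q₀ (Qp t)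

/-- Every quad of the plane has a perturbation family. [cite: SchrammSmirnov2011, proof of Lemma 5.1] -/
theorem nonempty_perturbFamily (Q₀ : Quad (univ : Set ℂ)) : Nonempty (PerturbFamily Q₀) := by
  classical
  obtain ⟨H, hH, t₀, ht₀, ht₀', hpert⟩ := exists_perturbations isOpen_univ Q₀
  refine ⟨PerturbFamily.mk H t₀
    (fun t => if h : 0 < t ∧ t ≤ t₀ then (hpert t h.1 h.2).choose else Q₀)
    (fun t => if h : 0 < t ∧ t ≤ t₀ then (hpert t h.1 h.2).choose_spec.choose else Q₀)
    ht₀ ht₀' hH (fun {t} ht htle p => ?_) (fun {t} ht htle p => ?_) (fun {t} ht htle => ?_)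
    (fun {t} ht htle => ?_)⟩
  · simp only [dif_pos (And.intro ht htle)]
    exact (hpert t ht htle).choose_spec.choose_spec.1 p
  · simp only [dif_pos (And.intro ht htle)]
    exact (hpert t ht htle).choose_spec.choose_spec.2.1 p
  · simp only [dif_pos (And.intro ht htle)]
    exact (hpert t ht htle).choose_spec.choose_spec.2.2.1
  · simp only [dif_pos (And.intro ht htle)]
    exact (hpert t ht htle).choose_spec.choose_spec.2.2.2

namespace PerturbFamily

variable {Q₀ : Quad (univ : Set ℂ)} (F : PerturbFamily Q₀)

/-- **The perturbations converge to `Q₀`** uniformly: for `r > 0` there is `s₀ > 0` such that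
`dist Q₋(t) Q₀ < r` and `dist Q₊(t) Q₀ < r` for `0 < t ≤ min s₀ t₀` (uniform continuity of `H`
on `[-2, 2]²`). [folklore] -/
theorem exists_dist_lt (r : ℝ) (hr : 0 < r) :
    ∃ s₀ : ℝ, 0 < s₀ ∧ ∀ t : ℝ, 0 < t → t ≤ s₀ → t ≤ F.t₀ →
      dist (F.Qm t) Q₀ < r ∧ dist (F.Qp t) Q₀ < r := by
  have hK : IsCompact (Icc (-2 : ℝ) 2 ×ℂ Icc (-2 : ℝ) 2) := isCompact_Icc.reProdIm isCompact_Icc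
  have hHu : UniformContinuousOn F.H (Icc (-2 : ℝ) 2 ×ℂ Icc (-2 : ℝ) 2) :=
    hK.uniformContinuousOn_of_continuous F.H.continuous.continuousOn
  obtain ⟨η, hη, hHη⟩ := Metric.uniformContinuousOn_iff.1 hHu (r / 2) (by positivity)
  refine ⟨η / 8, by positivity, fun t ht hts ht₀ => ?_⟩
  have ht12 : t ≤ 1 / 2 := ht₀.trans F.t₀_le
  have hchart : ∀ p : I × I, chartPt p ∈ Icc (-2 : ℝ) 2 ×ℂ Icc (-2 : ℝ) 2 := fun p => by
    have h := chart_mem_rect p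
    rw [Complex.mem_reProdIm, mem_Icc, mem_Icc] at h
    rw [show chartPt p = ((2 * (p.1 : ℝ) - 1 : ℝ) : ℂ) + ((2 * (p.2 : ℝ) - 1 : ℝ) : ℂ) * Complex.I from rfl,
      Complex.mem_reProdIm, mem_Icc, mem_Icc]
    exact ⟨⟨by linarith [h.1.1], by linarith [h.1.2]⟩, ⟨by linarith [h.2.1], by linarith [h.2.2]⟩⟩
  constructor
  · refine dist_lt_of_forall fun p => ?_
    rw [F.Qm_apply ht ht₀ p, ← F.apply_chartPt p]
    refine (hHη _ (shrinkChart_mem_rect ht.le (by linarith) p) _ (hchart p) ?_).trans (half_lt_self hr)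
    exact (dist_shrinkPt_le ht.le p).trans_lt (by linarith)
  · refine dist_lt_of_forall fun p => ?_
    rw [F.Qp_apply ht ht₀ p, ← F.apply_chartPt p]
    refine (hHη _ (unstretchChart_mem_rect ht.le ht12 p) _ (hchart p) ?_).trans (half_lt_self hr)
    exact (dist_stretchPt_le ht.le ht12 p).trans_lt (by linarith)

/-- **Smaller perturbations are strictly closer to `Q₀`, in the order**: for `0 < t ≤ t₀` there is
`s ∈ (0, t/2]` with `Q₋(t) < Q₋(s)` and `Q₊(s) < Q₊(t)` (the witnessing neighbourhoods of
`Q₋(t) < Q₀ < Q₊(t)` contain `Q₋(s)`, `Q₊(s)` for small `s`). [folklore] -/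
theorem exists_lt_lt {t : ℝ} (ht : 0 < t) (ht₀ : t ≤ F.t₀) :
    ∃ s : ℝ, 0 < s ∧ s ≤ t / 2 ∧ StrictlyDominated (F.Qm t) (F.Qm s) ∧ StrictlyDominated (F.Qp s) (F.Qp t) := by
  obtain ⟨U₁, U₂, hU₁, hU₂, h₁, h₂, hdom⟩ := strictlyDominated_iff.1 (F.Qm_lt ht ht₀)
  obtain ⟨V₁, V₂, hV₁, hV₂, h₁', h₂', hdom'⟩ := strictlyDominated_iff.1 (F.lt_Qp ht ht₀)
  obtain ⟨r₂, hr₂, hball₂⟩ := Metric.isOpen_iff.1 hU₂ Q₀ h₂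
  obtain ⟨r₁, hr₁, hball₁⟩ := Metric.isOpen_iff.1 hV₁ Q₀ h₁'
  obtain ⟨s₀, hs₀, hs⟩ := F.exists_dist_lt (min r₁ r₂) (lt_min hr₁ hr₂)
  set s := min s₀ (t / 2) with hsdef
  have hspos : 0 < s := lt_min hs₀ (by linarith)
  have hst₀ : s ≤ F.t₀ := ((min_le_right _ _).trans (by linarith)).trans ht₀
  obtain ⟨hm, hp⟩ := hs s hspos (min_le_left _ _) hst₀
  refine ⟨s, hspos, min_le_right _ _, ?_, ?_⟩
  · have hmem : F.Qm s ∈ U₂ := hball₂ (mem_ball.2 (hm.trans_le (min_le_right _ _)))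
    exact strictlyDominated_iff.2 ⟨U₁, U₂, hU₁, hU₂, h₁, hmem, hdom⟩
  · have hmem : F.Qp s ∈ V₁ := hball₁ (mem_ball.2 (hp.trans_le (min_le_left _ _)))
    exact strictlyDominated_iff.2 ⟨V₁, V₂, hV₁, hV₂, hmem, h₂', hdom'⟩

/-! ### A sequence of nested perturbations -/

/-- **Nested perturbation parameters**: `t_0 = t₀` and `t_{n+1} ∈ (0, t_n/2]` with
`Q₋(t_n) < Q₋(t_{n+1})` and `Q₊(t_{n+1}) < Q₊(t_n)` (`exists_lt_lt`). [folklore] -/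
def seq : ℕ → {t : ℝ // 0 < t ∧ t ≤ F.t₀}
  | 0 => ⟨F.t₀, F.t₀_pos, le_rfl⟩
  | n + 1 => ⟨(F.exists_lt_lt (seq n).2.1 (seq n).2.2).choose,
      (F.exists_lt_lt (seq n).2.1 (seq n).2.2).choose_spec.1,
      ((F.exists_lt_lt (seq n).2.1 (seq n).2.2).choose_spec.2.1.trans
        (by linarith [(seq n).2.1, (seq n).2.2]))⟩

/-- The parameters are positive. [folklore] -/
theorem seq_pos (n : ℕ) : 0 < (F.seq n : ℝ) := (F.seq n).2.1

/-- The parameters are admissible. [folklore] -/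
theorem seq_le (n : ℕ) : (F.seq n : ℝ) ≤ F.t₀ := (F.seq n).2.2

/-- The parameters at least halve at each step. [folklore] -/
theorem seq_succ_le (n : ℕ) : (F.seq (n + 1) : ℝ) ≤ F.seq n / 2 :=
  (F.exists_lt_lt (F.seq n).2.1 (F.seq n).2.2).choose_spec.2.1

/-- The inner perturbations increase strictly in the order. [folklore] -/
theorem Qm_seq_lt_succ (n : ℕ) : StrictlyDominated (F.Qm (F.seq n)) (F.Qm (F.seq (n + 1))) :=
  (F.exists_lt_lt (F.seq n).2.1 (F.seq n).2.2).choose_spec.2.2.1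

/-- The outer perturbations decrease strictly in the order. [folklore] -/
theorem Qp_seq_succ_lt (n : ℕ) : StrictlyDominated (F.Qp (F.seq (n + 1))) (F.Qp (F.seq n)) :=
  (F.exists_lt_lt (F.seq n).2.1 (F.seq n).2.2).choose_spec.2.2.2

/-- The parameters are dominated by `t₀ / 2^n`. [folklore] -/
theorem seq_le_pow (n : ℕ) : (F.seq n : ℝ) ≤ F.t₀ / 2 ^ n := by
  induction n with
  | zero => simp [seq]
  | succ n ih =>
    calc (F.seq (n + 1) : ℝ) ≤ F.seq n / 2 := F.seq_succ_le n
      _ ≤ F.t₀ / 2 ^ n / 2 := by gcongr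
      _ = F.t₀ / 2 ^ (n + 1) := by rw [pow_succ, div_div]

/-- The parameters tend to `0`. [folklore] -/
theorem tendsto_seq : Tendsto (fun n => (F.seq n : ℝ)) atTop (𝓝 0) := by
  refine squeeze_zero (fun n => (F.seq_pos n).le) F.seq_le_pow ?_
  have : Tendsto (fun n : ℕ => F.t₀ * (1 / 2) ^ n) atTop (𝓝 (F.t₀ * 0)) :=
    (tendsto_pow_atTop_nhds_zero_of_lt_one (by norm_num) (by norm_num)).const_mul _
  rw [mul_zero] at this
  refine this.congr fun n => ?_
  rw [one_div, inv_pow, div_eq_mul_inv]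

/-- Monotonicity of the inner perturbations along the sequence (`m < n`). [folklore] -/
theorem Qm_seq_lt {m n : ℕ} (h : m < n) : StrictlyDominated (F.Qm (F.seq m)) (F.Qm (F.seq n)) := by
  induction n with
  | zero => exact absurd h (Nat.not_lt_zero _)
  | succ n ih =>
    rcases Nat.lt_succ_iff_lt_or_eq.1 h with h' | rfl
    · exact (ih h').trans (F.Qm_seq_lt_succ n)
    · exact F.Qm_seq_lt_succ m

/-- Monotonicity of the outer perturbations along the sequence (`m < n`). [folklore] -/
theorem Qp_seq_lt {m n : ℕ} (h : m < n) : StrictlyDominated (F.Qp (F.seq n)) (F.Qp (F.seq m)) := by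
  induction n with
  | zero => exact absurd h (Nat.not_lt_zero _)
  | succ n ih =>
    rcases Nat.lt_succ_iff_lt_or_eq.1 h with h' | rfl
    · exact (F.Qp_seq_succ_lt n).trans (ih h')
    · exact F.Qp_seq_succ_lt m

/-- The inner perturbations along the sequence converge to `Q₀`. [folklore] -/
theorem tendsto_Qm_seq : Tendsto (fun n => F.Qm (F.seq n)) atTop (𝓝 Q₀) := by
  rw [Metric.tendsto_nhds]
  intro r hr
  obtain ⟨s₀, hs₀, hs⟩ := F.exists_dist_lt r hr
  filter_upwards [(tendsto_order.1 F.tendsto_seq).2 s₀ hs₀] with n hn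
  exact (hs _ (F.seq_pos n) hn.le (F.seq_le n)).1

/-- The outer perturbations along the sequence converge to `Q₀`. [folklore] -/
theorem tendsto_Qp_seq : Tendsto (fun n => F.Qp (F.seq n)) atTop (𝓝 Q₀) := by
  rw [Metric.tendsto_nhds]
  intro r hr
  obtain ⟨s₀, hs₀, hs⟩ := F.exists_dist_lt r hr
  filter_upwards [(tendsto_order.1 F.tendsto_seq).2 s₀ hs₀] with n hn
  exact (hs _ (F.seq_pos n) hn.le (F.seq_le n)).2

/-- Eventually the outer perturbations are strictly below any quad `Q > Q₀`. [folklore] -/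
theorem eventually_Qp_seq_lt {Q : Quad (univ : Set ℂ)} (h : StrictlyDominated Q₀ Q) :
    ∀ᶠ n in atTop, StrictlyDominated (F.Qp (F.seq n)) Q := by
  obtain ⟨U₁, U₂, hU₁, hU₂, h₁, h₂, hdom⟩ := strictlyDominated_iff.1 h
  filter_upwards [F.tendsto_Qp_seq (hU₁.mem_nhds h₁)] with n hn
  exact strictlyDominated_iff.2 ⟨U₁, U₂, hU₁, hU₂, hn, h₂, hdom⟩

end PerturbFamily

/-! ### The discrete continuity (5.1) from Lemma 5.1 -/

/-- **Schramm–Smirnov's discrete continuity estimate (5.1) for critical bond percolation on `δℤ²`,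
from their Lemma 5.1** (the converse of `SchrammSmirnov2011_lemma_5_1_of_continuity`, for the
plane `D = univ`). Assume `μ(∂⊞_{Q₀}) = 0` for every subsequential scaling limit `μ` in `ℋ_ℂ`
(`SchrammSmirnov2011_lemma_5_1`). Then for every quad `Q₀ ∈ 𝒬_ℂ` and `ε > 0` there are quads
`Q' < Q₀ < Q''` and `δ₀ > 0` such that for all meshes `0 < δ < δ₀`,
`P_{1/2}[Q' crossed inside the open edges of δℤ² ∧ Q'' not] ≤ ε`.
Proof (by contradiction, along the nested perturbations `Q₋(t_n) ↑`, `Q₊(t_n) ↓` of a perturbation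
family): otherwise there are meshes `δ_n → 0` with `P[Q₋(t_{n+1}) crossed ∧ Q₊(t_{n+1}) not] > ε`;
these events decrease in `n` and are contained in `{S_ω ∈ F_m}`,
`F_m = ⊞_{Q₋(t_{m+1})} ∩ closure V^{Q₊(t_m)}` (closed, decreasing), so any weak subsequential limit
`μ` of the laws `μ_{δ_n}` (compactness of the probability measures on the compact metrizable `ℋ_ℂ`,
Schramm–Smirnov Thm. 1.4 / Cor. 1.6) has `μ(F_m) ≥ ε` by the portmanteau theorem, hence
`μ(⋂ F_m) ≥ ε`; but `⋂ F_m ⊆ ∂⊞_{Q₀} = {Q₀ crossed, no Q > Q₀ crossed}`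
(`QuadConfig.frontier_crossedEvent_eq`), contradicting Lemma 5.1.
[cite: SchrammSmirnov2011, Lemma 5.1 and eq. (5.1)] -/
theorem continuity_of_lemma_5_1 (h51 : SchrammSmirnov2011_lemma_5_1) (Q₀ : Quad (univ : Set ℂ))
    (ε : ℝ≥0∞) (hε : 0 < ε) :
    ∃ Q' Q'' : Quad (univ : Set ℂ), StrictlyDominated Q' Q₀ ∧ StrictlyDominated Q₀ Q'' ∧
      ∃ δ₀ : ℝ, 0 < δ₀ ∧ ∀ δ : ℝ, 0 < δ → δ < δ₀ →
        bondPercolation (zdGraph 2) half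
          {ω | (∃ K, Q'.IsCrossing K ∧ K ⊆ openEdgeUnion δ ω) ∧
            ¬ ∃ K, Q''.IsCrossing K ∧ K ⊆ openEdgeUnion δ ω} ≤ ε := by
  classical
  obtain ⟨F⟩ := nonempty_perturbFamily Q₀
  -- notation
  set Qm : ℕ → Quad (univ : Set ℂ) := fun n => F.Qm (F.seq n)
  set Qp : ℕ → Quad (univ : Set ℂ) := fun n => F.Qp (F.seq n)
  have hQm_lt : ∀ n, StrictlyDominated (Qm n) Q₀ := fun n => F.Qm_lt (F.seq_pos n) (F.seq_le n)
  have hlt_Qp : ∀ n, StrictlyDominated Q₀ (Qp n) := fun n => F.lt_Qp (F.seq_pos n) (F.seq_le n)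
  set E : ℕ → ℝ → Set (BondConfig (Site 2)) := fun k δ =>
    {ω | (∃ K, (Qm k).IsCrossing K ∧ K ⊆ openEdgeUnion δ ω) ∧
      ¬ ∃ K, (Qp k).IsCrossing K ∧ K ⊆ openEdgeUnion δ ω}
  by_contra hcon
  -- meshes `δ n < 1/(n+1)` with `ε < P(E (n+1) (δ n))`
  have hδ : ∀ n : ℕ, ∃ δ : ℝ, 0 < δ ∧ δ < 1 / (n + 1) ∧
      ε < bondPercolation (zdGraph 2) half (E (n + 1) δ) := by
    intro n
    by_contra h'
    push Not at h'
    exact hcon ⟨Qm (n + 1), Qp (n + 1), hQm_lt _, hlt_Qp _, 1 / (n + 1), by positivity,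
      fun δ' hδ' hδ'lt => h' δ' hδ' hδ'lt⟩
  choose δ hδpos hδlt hδE using hδ
  -- monotonicity of the events in the level
  have hEmono : ∀ {m k : ℕ}, m ≤ k → ∀ δ, E k δ ⊆ E m δ := by
    intro m k hmk δ ω hω
    obtain ⟨⟨K, hK, hKO⟩, hno⟩ := hω
    rcases hmk.lt_or_eq with hlt | rfl
    · refine ⟨?_, fun ⟨K', hK', hK'O⟩ => hno ?_⟩
      · obtain ⟨K₁, hK₁K, hK₁⟩ := (F.Qm_seq_lt hlt).dominated K hK
        exact ⟨K₁, hK₁, hK₁K.trans hKO⟩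
      · obtain ⟨K₁, hK₁K, hK₁⟩ := (F.Qp_seq_lt hlt).dominated K' hK'
        exact ⟨K₁, hK₁, hK₁K.trans hK'O⟩
    · exact ⟨⟨K, hK, hKO⟩, hno⟩
  -- the closed decreasing sets `F m` of `ℋ_ℂ`
  set G : ℕ → Set (QuadConfig (univ : Set ℂ)) := fun m =>
    QuadConfig.crossedEvent (Qm (m + 1)) ∩ closure (QuadConfig.notCrossed (Qp m))
  have hGclosed : ∀ m, IsClosed (G m) := fun m =>
    (QuadConfig.isClosed_crossedEvent _).inter isClosed_closure
  have hGanti : Antitone G := by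
    refine antitone_nat_of_succ_le fun m => ?_
    refine inter_subset_inter (fun S hS => ?_) (closure_mono fun S hS hmem => ?_)
    · exact S.isLowerQuadSet hS (F.Qm_seq_lt_succ (m + 1))
    · exact hS (S.isLowerQuadSet hmem (F.Qp_seq_succ_lt m))
  have hEG : ∀ m δ', E (m + 1) δ' ⊆ {ω | z2QuadConfig univ δ' ω ∈ G m} := by
    rintro m δ' ω ⟨⟨K, hK, hKO⟩, hno⟩
    refine ⟨mem_z2QuadConfig_of_isCrossing hK hKO, subset_closure fun hmem => hno ?_⟩
    have hmem' : Qp m ∈ (z2QuadConfig univ δ' ω : Set (Quad (univ : Set ℂ))) := hmem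
    rw [coe_z2QuadConfig] at hmem'
    exact exists_isCrossing_of_mem_closure (F.Qp_seq_succ_lt m) hmem'
  -- the laws as probability measures on the compact metrizable `ℋ_ℂ`, and a weak limit
  haveI : T2Space (QuadConfig (univ : Set ℂ)) :=
    (SchrammSmirnov2011_thm_1_4_holds univ isOpen_univ univ_nonempty).1.2.2
  haveI : CompactSpace (QuadConfig (univ : Set ℂ)) := QuadConfig.compactSpace
  haveI : HasOuterApproxClosed (QuadConfig (univ : Set ℂ)) :=
    QuadConfig.hasOuterApproxClosed isOpen_univ univ_nonempty
  haveI : TopologicalSpace.MetrizableSpace (QuadConfig (univ : Set ℂ)) :=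
    (SchrammSmirnov2011_thm_1_4_holds univ isOpen_univ univ_nonempty).1.2.1
  haveI : TopologicalSpace.SeparableSpace (QuadConfig (univ : Set ℂ)) := by
    letI := TopologicalSpace.metrizableSpaceMetric (QuadConfig (univ : Set ℂ))
    infer_instance
  haveI hprob : ∀ n, IsProbabilityMeasure (z2QuadLaw univ (δ n) : Measure (QuadConfig (univ : Set ℂ))) :=
    fun n => isProbabilityMeasure_z2QuadLaw_of_pos isOpen_univ (hδpos n)
  set π : ℕ → ProbabilityMeasure (QuadConfig (univ : Set ℂ)) := fun n =>
    ⟨(z2QuadLaw univ (δ n) : Measure (QuadConfig (univ : Set ℂ))), hprob n⟩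
  have hπF : ∀ n, (π n).toFiniteMeasure = z2QuadLaw univ (δ n) := fun n => rfl
  obtain ⟨πlim, -, φ, hφ, hlim⟩ := isCompact_univ.tendsto_subseq (x := π) fun n => mem_univ _
  set μ : FiniteMeasure (QuadConfig (univ : Set ℂ)) := πlim.toFiniteMeasure
  have hlimF : Tendsto (fun k => z2QuadLaw univ (δ (φ k))) atTop (𝓝 μ) := by
    have := (ProbabilityMeasure.tendsto_nhds_iff_toFiniteMeasure_tendsto_nhds _).1 hlim
    simpa only [Function.comp_def, hπF] using this
  -- `μ` is a subsequential scaling limit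
  have hδφ : Tendsto (fun k => δ (φ k)) atTop (𝓝 0) := by
    refine squeeze_zero (fun k => (hδpos _).le) (fun k => (hδlt (φ k)).le) ?_
    have h1 : Tendsto (fun k : ℕ => (1 : ℝ) / ((k : ℝ) + 1)) atTop (𝓝 0) :=
      tendsto_one_div_add_atTop_nhds_zero_nat
    refine squeeze_zero (fun k => by positivity) (fun k => ?_) h1
    have : (k : ℝ) ≤ φ k := by exact_mod_cast hφ.id_le k
    exact one_div_le_one_div_of_le (by positivity) (by linarith)
  have hμ : IsSubseqQuadLimit univ μ :=
    (isSubseqQuadLimit_iff univ μ).2 ⟨fun k => δ (φ k), fun k => hδpos _, hδφ, hlimF⟩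
  -- portmanteau: `μ (G m) ≥ ε`
  have hGε : ∀ m, ε ≤ (μ : Measure (QuadConfig (univ : Set ℂ))) (G m) := by
    intro m
    refine le_trans ?_ (FiniteMeasure.limsup_measure_closed_le_of_tendsto hlimF (hGclosed m))
    refine le_limsup_of_frequently_le (Eventually.frequently ?_) (by isBoundedDefault)
    filter_upwards [eventually_ge_atTop m] with k hk
    have hmk : m ≤ φ k := hk.trans (hφ.id_le k)
    calc ε ≤ bondPercolation (zdGraph 2) half (E (φ k + 1) (δ (φ k))) := (hδE (φ k)).le
      _ ≤ bondPercolation (zdGraph 2) half (E (m + 1) (δ (φ k))) :=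
          measure_mono (hEmono (Nat.succ_le_succ hmk) _)
      _ ≤ bondPercolation (zdGraph 2) half {ω | z2QuadConfig univ (δ (φ k)) ω ∈ G m} :=
          measure_mono (hEG m _)
      _ = (z2QuadLaw univ (δ (φ k)) : Measure (QuadConfig (univ : Set ℂ))) (G m) := by
          rw [z2QuadLaw_apply isOpen_univ (hδpos _) (hGclosed m).measurableSet]; rfl
  -- hence `μ (⋂ G m) ≥ ε`
  have hμI : ε ≤ (μ : Measure (QuadConfig (univ : Set ℂ))) (⋂ m, G m) := by
    rw [hGanti.measure_iInter (fun m => (hGclosed m).measurableSet.nullMeasurableSet)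
      ⟨0, measure_ne_top _ _⟩]
    exact le_iInf hGε
  -- but `⋂ G m ⊆ ∂⊞_{Q₀}`, a `μ`-null set by Lemma 5.1
  have hsub : (⋂ m, G m) ⊆ frontier (QuadConfig.crossedEvent Q₀) := by
    intro S hS
    rw [mem_iInter] at hS
    rw [QuadConfig.frontier_crossedEvent_eq]
    refine ⟨?_, fun Q hQ hQS => ?_⟩
    · -- `Q₀ ∈ S`: limit of `Qm (m+1) ∈ S`, `S` closed
      have hc : IsClosed (S : Set (Quad (univ : Set ℂ))) := S.2.1
      refine hc.mem_of_tendsto ((F.tendsto_Qm_seq).comp (tendsto_add_atTop_nat 1))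
        (Eventually.of_forall fun m => ?_)
      exact (hS m).1
    · -- no `Q > Q₀` in `S`: else `Qp n ∈ S` for large `n`, but `Qp m ∉ S` for all `m`
      have hnot : ∀ m, Qp m ∉ S := fun m =>
        QuadConfig.closure_notCrossed_subset isOpen_univ (F.Qp_seq_succ_lt m) (hS (m + 1)).2
      obtain ⟨n, hn⟩ := (F.eventually_Qp_seq_lt hQ).exists
      exact hnot n (S.isLowerQuadSet hQS hn)
  have hzero := h51 univ isOpen_univ univ_nonempty μ hμ Q₀
  have : ε ≤ 0 := hμI.trans ((measure_mono hsub).trans hzero.le)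
  exact (not_le.2 hε) this

end Quad

end QuadCrossing

/-! ### DKKMO Cor. 1.3 modulo Theorem 1.2 (`d_SS`) and Schramm–Smirnov's Lemma 5.1 -/

open QuadCrossing in
/-- **DKKMO's Corollary 1.3 at `q = 1` from the Schramm–Smirnov half of their Theorem 1.2 and
Schramm–Smirnov's Lemma 5.1** (the named fact `SchrammSmirnov2011_lemma_5_1`): the continuity
hypothesis of `dkkmo_crossing_rotation_invariance_of_schrammSmirnov` is supplied by
`Quad.continuity_of_lemma_5_1`. With this, `dkkmo_crossing_rotation_invariance` rests on two
published statements: DKKMO Thm. 1.2 (`d_SS` part; hypothesis `hSS`, see that file for the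
rendering) and SS11 Lemma 5.1. [cite: DKKMO2020Rotational, Cor. 1.3 (q = 1), proof §7.1 p. 43] -/
theorem dkkmo_crossing_rotation_invariance_of_schrammSmirnov_of_lemma_5_1
    (hSS : ∀ ε : ℝ, 0 < ε →
      ∀ N : Set (QuadCrossingSpace (univ : Set ℂ) × QuadCrossingSpace (univ : Set ℂ)), IsOpen N →
        (∀ S, (S, S) ∈ N) →
        ∃ δ₀ : ℝ, 0 < δ₀ ∧ ∀ α ∈ Set.Ioo ε (Real.pi - ε), ∀ δ : ℝ, 0 < δ → δ ≤ δ₀ →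
          ∃ P : Measure (BondConfig (Site 2) × BondConfig (Site 2)),
            P.map Prod.fst = bondPercolation (zdGraph 2) half ∧
            P.map Prod.snd = bondPercolation (zdGraph 2) half ∧
            P {p | (z2QuadConfig univ δ p.1, QuadConfig.rotate α (z2QuadConfig univ δ p.2)) ∉ N} <
              ENNReal.ofReal ε)
    (h51 : SchrammSmirnov2011_lemma_5_1) :
    dkkmo_crossing_rotation_invariance :=
  dkkmo_crossing_rotation_invariance_of_schrammSmirnov hSS
    fun Q₀ ε hε => Quad.continuity_of_lemma_5_1 h51 Q₀ ε hε

open QuadCrossing in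
/-- The same with the Schramm–Smirnov half of DKKMO's Theorem 1.2 in its printed metric form
`ℙ[d_SS(ω_δ, e^{iα}ω'_δ) > ε] < ε` for a (continuous, separating) distance `d_SS` on `𝔥`
(`dkkmo_crossing_rotation_invariance_of_schrammSmirnov_dist`) and the named fact
`SchrammSmirnov2011_lemma_5_1`. [cite: DKKMO2020Rotational, Cor. 1.3 (q = 1), proof §7.1 p. 43] -/
theorem dkkmo_crossing_rotation_invariance_of_schrammSmirnov_dist_of_lemma_5_1
    (d : QuadCrossingSpace (univ : Set ℂ) → QuadCrossingSpace (univ : Set ℂ) → ℝ)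
    (hdc : Continuous fun p : QuadCrossingSpace (univ : Set ℂ) × QuadCrossingSpace (univ : Set ℂ) => d p.1 p.2)
    (hdpos : ∀ S S', S ≠ S' → 0 < d S S')
    (hSSd : ∀ ε : ℝ, 0 < ε → ∃ δ₀ : ℝ, 0 < δ₀ ∧ ∀ α ∈ Set.Ioo ε (Real.pi - ε), ∀ δ : ℝ, 0 < δ → δ ≤ δ₀ →
      ∃ P : Measure (BondConfig (Site 2) × BondConfig (Site 2)),
        P.map Prod.fst = bondPercolation (zdGraph 2) half ∧
        P.map Prod.snd = bondPercolation (zdGraph 2) half ∧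
        P {p | ε < d (z2QuadConfig univ δ p.1) (QuadConfig.rotate α (z2QuadConfig univ δ p.2))} <
          ENNReal.ofReal ε)
    (h51 : SchrammSmirnov2011_lemma_5_1) :
    dkkmo_crossing_rotation_invariance :=
  dkkmo_crossing_rotation_invariance_of_schrammSmirnov_dist d hdc hdpos hSSd
    fun Q₀ ε hε => Quad.continuity_of_lemma_5_1 h51 Q₀ ε hε

end Literature.Probability.Percolation
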